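import Literature.AlgebraicGeometry.Frobenioids.EquivalencePreStepsFSMFF2008Assembly
import Literature.AlgebraicGeometry.Frobenioids.Thm42OfPreStepsGeneral
import HarnessLib

/-!
# Frobenioids I, Theorem 4.2 (i)(ii)(iii) AS TYPED for every pair of Frobenioids with perf-factorial
# divisor monoids — Thm. 3.4 (ii) AS PRINTED fed into the "modulo pre-steps" closers

Mochizuki, *The geometry of Frobenioids I: the general theory*, Kyushu J. Math. **62** (2008) 293–400,
Thm. 4.2 p. 77 (proof pp. 78–81), Thm. 3.4 (ii) p. 62 [cite: MochizukiFrdI2008, Thm. 4.2 p.77].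

PROOF-ONLY file (seat abc-iut-L1-t11; no definitions). Seat abc-iut-w4-d105's `Thm42OfPreStepsGeneral.lean`
proves the typed [FrdI] Thm. 4.2 (i), (ii), (iii) at `ofFunctor` for Frobenioids NOT assumed of perfect type
MODULO ONLY "`Ψ`, `Ψ⁻¹` preserve pre-steps" (`FrdI.T42.thm42i_ofFunctor_of_preservesPreSteps`, `…ii…`, `…iii…`),
and instantiates it over bases of FSMFF-type in the author's revised (2024) sense. With [FrdI] Thm. 3.4 (ii) now
a theorem AS PRINTED (`FrdI.isPreStep_map_of_quasiIsotropic_of_isOfFSMFFType`,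
`EquivalencePreStepsFSMFF2008Assembly.lean`, over seat abc-iut-L1-t13's core `EquivalencePreStepsFSMFF2008.lean`)
the pre-step hypothesis is discharged from the typed `Thm42Setting` ITSELF — its standard type (Def. 3.1 (i)(d))
carries the printed FSMFF condition on both bases:

* `FrdI.T42.thm42i_ofFunctor`, `FrdI.T42.thm42ii_ofFunctor`, `FrdI.T42.thm42iii_ofFunctor` — the typed
  `PreFrobenioidData.Thm42i` / `Thm42ii` / `Thm42iii` at `ofFunctor` for EVERY pair of Frobenioids
  `C_i → F_{Φ_i}` with `Φ_i` perf-factorial and every equivalence `Ψ` (for (iii): every prime bijection `e`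
  compatible with `Ψ` as in the typed statement). No base hypothesis, no 2024 revision, no perfectness.

The 0-ary named fact `FrdI.Thm42i` (cell FACT-LIST F-0716) is then the one-liner
`fun F₁ F₂ hF₁ hF₂ hpf₁ hpf₂ Ψ => FrdI.T42.thm42i_ofFunctor Ψ hF₁ hF₂ hpf₁ hpf₂` — left to its claimant
(seat abc-iut-f-037) by the cell's fact-claim protocol. Nothing is restated; no statement of the paper is
strengthened; nothing here bears on [IUTchIII].
-/

set_option backward.isDefEq.respectTransparency false

namespace Literature.AlgebraicGeometry.Frobenioids

open CategoryTheory Opposite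

/-! ### [FrdI] Thm. 4.2 (i)(ii)(iii) AS TYPED, for every pair of Frobenioids with perf-factorial divisor monoids -/

namespace FrdI.T42

section

universe w v v' u u'

variable {D₁ : Type u} [Category.{v} D₁] {Φ₁ : D₁ᵒᵖ ⥤ CommMonCat.{w}} {C₁ : Type u'} [Category.{v'} C₁]
  {D₂ : Type u} [Category.{v} D₂] {Φ₂ : D₂ᵒᵖ ⥤ CommMonCat.{w}} {C₂ : Type u'} [Category.{v'} C₂]
  {F₁ : C₁ ⥤ ElemFrobenioid Φ₁} {F₂ : C₂ ⥤ ElemFrobenioid Φ₂} (Ψ : C₁ ≌ C₂)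

/-- **[FrdI] Theorem 4.2 (i) AS TYPED, for every pair of Frobenioids with perf-factorial divisor monoids
and every `Ψ`** (no base hypothesis beyond the typed `Thm42Setting`, whose standard type (d) is the PRINTED
2008 FSMFF condition): seat abc-iut-w4-d105's `thm42i_ofFunctor_of_preservesPreSteps` fed with Thm. 3.4 (ii)
as printed (`FrdI.isPreStep_map_of_quasiIsotropic_of_isOfFSMFFType`). [cite: MochizukiFrdI2008, Thm. 4.2 (i) p.77] -/
theorem thm42i_ofFunctor (hF₁ : PreFrobenioid.IsFrobenioid F₁) (hF₂ : PreFrobenioid.IsFrobenioid F₂)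
    (hpf₁ : Objectwise (fun M _ => IsPerfFactorial M) Φ₁) (hpf₂ : Objectwise (fun M _ => IsPerfFactorial M) Φ₂) :
    (PreFrobenioidData.ofFunctor Φ₁ F₁).Thm42i (PreFrobenioidData.ofFunctor Φ₂ F₂) Ψ := fun hT =>
  thm42i_ofFunctor_of_preservesPreSteps Ψ hF₁ hF₂ hpf₁ hpf₂
    (fun _ _ _ h => FrdI.isPreStep_map_of_quasiIsotropic_of_isOfFSMFFType hF₁ hF₂
      hT.standard.1.quasiIsotropic hT.standard.2.quasiIsotropic hT.standard.2.fsmff Ψ h)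
    (fun _ _ _ h => FrdI.isPreStep_map_of_quasiIsotropic_of_isOfFSMFFType hF₂ hF₁
      hT.standard.2.quasiIsotropic hT.standard.1.quasiIsotropic hT.standard.1.fsmff Ψ.symm h) hT

/-- **[FrdI] Theorem 4.2 (ii) AS TYPED**, same generality. [cite: MochizukiFrdI2008, Thm. 4.2 (ii) p.77] -/
theorem thm42ii_ofFunctor (hF₁ : PreFrobenioid.IsFrobenioid F₁) (hF₂ : PreFrobenioid.IsFrobenioid F₂)
    (hpf₁ : Objectwise (fun M _ => IsPerfFactorial M) Φ₁) (hpf₂ : Objectwise (fun M _ => IsPerfFactorial M) Φ₂) :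
    (PreFrobenioidData.ofFunctor Φ₁ F₁).Thm42ii (PreFrobenioidData.ofFunctor Φ₂ F₂) Ψ := fun hT =>
  thm42ii_ofFunctor_of_preservesPreSteps Ψ hF₁ hF₂ hpf₁ hpf₂
    (fun _ _ _ h => FrdI.isPreStep_map_of_quasiIsotropic_of_isOfFSMFFType hF₁ hF₂
      hT.standard.1.quasiIsotropic hT.standard.2.quasiIsotropic hT.standard.2.fsmff Ψ h)
    (fun _ _ _ h => FrdI.isPreStep_map_of_quasiIsotropic_of_isOfFSMFFType hF₂ hF₁
      hT.standard.2.quasiIsotropic hT.standard.1.quasiIsotropic hT.standard.1.fsmff Ψ.symm h) hT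

/-- **[FrdI] Theorem 4.2 (iii) AS TYPED** (for every candidate prime bijection `e` compatible with `Ψ` on
co-angular pre-steps, as in the typed statement), same generality. [cite: MochizukiFrdI2008, Thm. 4.2 (iii) p.77] -/
theorem thm42iii_ofFunctor (hF₁ : PreFrobenioid.IsFrobenioid F₁) (hF₂ : PreFrobenioid.IsFrobenioid F₂)
    (hpf₁ : Objectwise (fun M _ => IsPerfFactorial M) Φ₁) (hpf₂ : Objectwise (fun M _ => IsPerfFactorial M) Φ₂)
    (e : ∀ A : C₁, Primes (Φ₁.obj (op (PreFrobenioid.baseObj F₁ A))) ≃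
      Primes (Φ₂.obj (op (PreFrobenioid.baseObj F₂ (Ψ.functor.obj A)))))
    (he : ∀ (A : C₁) (𝔭 : Primes (Φ₁.obj (op (PreFrobenioid.baseObj F₁ A)))),
      (∀ ⦃B : C₁⦄ (φ : A ⟶ B), PreFrobenioid.IsCoAngularPreStep F₁ φ →
          (PreFrobenioid.Div F₁ φ ∈ 𝔭.submonoid ↔
            PreFrobenioid.Div F₂ (Ψ.functor.map φ) ∈ (e A 𝔭).submonoid)) ∧
        ∀ ⦃B : C₁⦄ (ψ : B ⟶ A), PreFrobenioid.IsCoAngularPreStep F₁ ψ →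
          ((∃ y ∈ 𝔭.submonoid, Frobenioids.pull Φ₁ (PreFrobenioid.Base F₁ ψ) y = PreFrobenioid.Div F₁ ψ) ↔
            ∃ y ∈ (e A 𝔭).submonoid, Frobenioids.pull Φ₂ (PreFrobenioid.Base F₂ (Ψ.functor.map ψ)) y =
              PreFrobenioid.Div F₂ (Ψ.functor.map ψ))) :
    (PreFrobenioidData.ofFunctor Φ₁ F₁).Thm42iii (PreFrobenioidData.ofFunctor Φ₂ F₂) Ψ e := fun hT =>
  thm42iii_ofFunctor_of_preservesPreSteps Ψ hF₁ hF₂ hpf₁ hpf₂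
    (fun _ _ _ h => FrdI.isPreStep_map_of_quasiIsotropic_of_isOfFSMFFType hF₁ hF₂
      hT.standard.1.quasiIsotropic hT.standard.2.quasiIsotropic hT.standard.2.fsmff Ψ h)
    (fun _ _ _ h => FrdI.isPreStep_map_of_quasiIsotropic_of_isOfFSMFFType hF₂ hF₁
      hT.standard.2.quasiIsotropic hT.standard.1.quasiIsotropic hT.standard.1.fsmff Ψ.symm h) e he hT

end

end FrdI.T42

end Literature.AlgebraicGeometry.Frobenioids
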